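import Literature.Analysis.FluidPDE.GaussianVortexPoincare
import Literature.Analysis.FluidPDE.GaussianVortexLinearLam
import Mathlib.MeasureTheory.Measure.Lebesgue.Basic
import HarnessLib

/-!
# The Poincaré inequality for the anisotropic Gaussian `𝒢_λ` of the asymmetric Burgers vortex

Analysis/FluidPDE file (all results proved, no definitions, no named facts), part of the linear
theory behind the named fact `Literature.Analysis.FluidPDE.GallayMaekawa2016_thm41`
(Gallay–Maekawa 2016, Thm. 4.1). For the anisotropic Gaussian of Gallay–Maekawa 2016, (4.4),
`𝒢_λ(x) = √(1−λ²)/(4π) · exp(−(1+λ)x₀²/4 − (1−λ)x₁²/4)` (`λ ∈ (−1,1)`; `𝒢₀ = G`), written out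
explicitly (no new definition):

* `integral_comp_diag_fin_two` — the diagonal change of variables on `ℝ²`:
  `∫ Φ(a x₀, b x₁) dx = |ab|⁻¹ ∫ Φ` (`a, b ≠ 0`);
* `integral_comp_diagLam_mul_gaussVortexProfile` — `𝒢_λ(y)dy` is the image of the Gaussian-vortex
  measure `G(x)dx` under `x ↦ (x₀/√(1+λ), x₁/√(1−λ))`:
  `∫ ψ(x₀/√(1+λ), x₁/√(1−λ)) G(x) dx = ∫ ψ 𝒢_λ`; in particular `∫ 𝒢_λ = 1`
  (`integral_gaussLam`);
* `sq_integral_gaussLam_poincare` — **the Poincaré inequality for `𝒢_λ` with its sharp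
  anisotropic Dirichlet form**: for `h ∈ C¹` with `h, Dh` bounded,
  `∫ h²𝒢_λ − (∫ h𝒢_λ)² ≤ 2 ∫ ((∂₀h)²/(1+λ) + (∂₁h)²/(1−λ)) 𝒢_λ`
  (the covariance of `𝒢_λ` is `diag(2/(1+λ), 2/(1−λ))`), transported from the isotropic case
  `sq_integral_gaussVortexProfile_poincare` along the diagonal map; and the mean-zero /
  isotropic-form corollaries `integral_sq_mul_gaussLam_le`, `integral_sq_mul_expNegQuadLam_le`:
  for `0 ≤ λ < 1` and `∫ h𝒢_λ = 0`, `∫ h²𝒢_λ ≤ (2/(1−λ)) ∫ ‖Dh‖² 𝒢_λ` — the constant `(1−λ)/2` is the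
  spectral gap of `L_λ` in `L²(𝒢_λ⁻¹dx)` (`GaussianVortexLinearLamGap`), positive exactly for
  `λ < 1`, which is why Theorem 4.1 of Gallay–Maekawa requires `λ ∈ [0,1)`.

## References

* Th. Gallay, Y. Maekawa, *Existence and stability of viscous vortices*, arXiv:1610.08384, §4.1,
  (4.4)–(4.6). [GallayMaekawa2016]
* D. Bakry, I. Gentil, M. Ledoux, *Analysis and Geometry of Markov Diffusion Operators*, Springer
  2014, Prop. 4.1.1 (Gaussian Poincaré inequality with general covariance). [folklore]
-/

open MeasureTheory Filter Set WithLp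
open scoped Real RealInnerProductSpace Topology

noncomputable section

namespace Literature.Analysis.FluidPDE

open Literature.Analysis.UnboundedOperators

/-! ### The diagonal change of variables on `ℝ²` -/

/-- **Diagonal change of variables on `ℝ²`**: for `a, b ≠ 0` and any `Φ`,
`∫ Φ(a x₀, b x₁) dx = |ab|⁻¹ ∫ Φ(y) dy` (Lebesgue measure scales by `|det diag(a,b)|⁻¹`,
`Real.map_linearMap_volume_pi_eq_smul_volume_pi`). [folklore] -/
theorem integral_comp_diag_fin_two {a b : ℝ} (ha : a ≠ 0) (hb : b ≠ 0)
    (Φ : EuclideanSpace ℝ (Fin 2) → ℝ) :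
    ∫ x : EuclideanSpace ℝ (Fin 2), Φ (toLp 2 ![a * x 0, b * x 1]) = |a * b|⁻¹ * ∫ y, Φ y := by
  set d : Fin 2 → ℝ := ![a, b] with hd_def
  have hd : ∀ i, d i ≠ 0 := fun i => by fin_cases i <;> simpa [d]
  -- the coordinate scaling as a measurable equivalence of `Fin 2 → ℝ`
  let e : (Fin 2 → ℝ) ≃ᵐ (Fin 2 → ℝ) :=
    { toFun := fun v i => d i * v i
      invFun := fun v i => (d i)⁻¹ * v i
      left_inv := fun v => by funext i; simp [hd i]
      right_inv := fun v => by funext i; simp [hd i]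
      measurable_toFun := measurable_pi_lambda _ fun i => (measurable_pi_apply i).const_mul _
      measurable_invFun := measurable_pi_lambda _ fun i => (measurable_pi_apply i).const_mul _ }
  have he_apply : ∀ v, (e v) = fun i => d i * v i := fun v => rfl
  have he : (e : (Fin 2 → ℝ) → Fin 2 → ℝ) = Matrix.toLin' (Matrix.diagonal d) := by
    funext v
    rw [he_apply, Matrix.toLin'_apply]
    funext i
    rw [Matrix.mulVec_diagonal]
  have hdet : LinearMap.det (Matrix.toLin' (Matrix.diagonal d)) ≠ 0 := by
    rw [LinearMap.det_toLin', Matrix.det_diagonal, Fin.prod_univ_two]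
    exact mul_ne_zero (hd 0) (hd 1)
  have hmap : Measure.map e volume = ENNReal.ofReal |(a * b)⁻¹| • (volume : Measure (Fin 2 → ℝ)) := by
    rw [he, Real.map_linearMap_volume_pi_eq_smul_volume_pi hdet, LinearMap.det_toLin',
      Matrix.det_diagonal, Fin.prod_univ_two]
    simp [d]
  calc ∫ x : EuclideanSpace ℝ (Fin 2), Φ (toLp 2 ![a * x 0, b * x 1])
      = ∫ v : Fin 2 → ℝ, Φ (toLp 2 (e v)) := by
        rw [← integral_comp_toLp_fin_two]
        congr 1
        funext v
        congr 2
        rw [he_apply]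
        funext i
        fin_cases i <;> simp [d]
    _ = ∫ w : Fin 2 → ℝ, Φ (toLp 2 w) ∂(Measure.map e volume) :=
        (integral_map_equiv e fun w => Φ (toLp 2 w)).symm
    _ = |a * b|⁻¹ * ∫ w : Fin 2 → ℝ, Φ (toLp 2 w) := by
        rw [hmap, integral_smul_measure, ENNReal.toReal_ofReal (abs_nonneg _), abs_inv,
          smul_eq_mul]
    _ = |a * b|⁻¹ * ∫ y, Φ y := by rw [integral_comp_toLp_fin_two]

/-- The squared norm of a point of `ℝ²` given by its two coordinates. [folklore] -/
theorem norm_sq_toLp_fin_two (p q : ℝ) :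
    ‖(toLp 2 ![p, q] : EuclideanSpace ℝ (Fin 2))‖ ^ 2 = p ^ 2 + q ^ 2 := by
  rw [EuclideanSpace.norm_sq_eq]
  simp [Fin.sum_univ_two]

/-! ### `𝒢_λ` as the image of `G` under the diagonal scaling -/

section GaussLam

variable {lam : ℝ} (hlam : lam ∈ Set.Ioo (-1 : ℝ) 1)
include hlam

/-- **`𝒢_λ dy` is the push-forward of `G dx` under `x ↦ (x₀/√(1+λ), x₁/√(1−λ))`**: for every `ψ`,
`∫ ψ(x₀/√(1+λ), x₁/√(1−λ)) G(x) dx = ∫ ψ(y) 𝒢_λ(y) dy` with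
`𝒢_λ(y) = √(1−λ²)/(4π) exp(−(1+λ)y₀²/4 − (1−λ)y₁²/4)` (Gallay–Maekawa 2016, (4.4)) and
`G = (4π)⁻¹e^{−|x|²/4}` the Gaussian vortex. [cite: GallayMaekawa2016, (4.4)] -/
theorem integral_comp_diagLam_mul_gaussVortexProfile (ψ : EuclideanSpace ℝ (Fin 2) → ℝ) :
    ∫ x : EuclideanSpace ℝ (Fin 2),
        ψ (toLp 2 ![(Real.sqrt (1 + lam))⁻¹ * x 0, (Real.sqrt (1 - lam))⁻¹ * x 1]) *
          gaussVortexProfile x =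
      ∫ y : EuclideanSpace ℝ (Fin 2), ψ y * (Real.sqrt (1 - lam ^ 2) / (4 * Real.pi) *
        Real.exp (-((1 + lam) / 4 * y 0 ^ 2 + (1 - lam) / 4 * y 1 ^ 2))) := by
  obtain ⟨hl0, hl1⟩ := hlam
  have hp : 0 < 1 + lam := by linarith
  have hq : 0 < 1 - lam := by linarith
  set s₀ : ℝ := Real.sqrt (1 + lam) with hs₀
  set s₁ : ℝ := Real.sqrt (1 - lam) with hs₁
  have hs₀p : 0 < s₀ := Real.sqrt_pos.2 hp
  have hs₁p : 0 < s₁ := Real.sqrt_pos.2 hq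
  have hs₀sq : s₀ ^ 2 = 1 + lam := Real.sq_sqrt hp.le
  have hs₁sq : s₁ ^ 2 = 1 - lam := Real.sq_sqrt hq.le
  have hprod : s₀ * s₁ = Real.sqrt (1 - lam ^ 2) := by
    rw [hs₀, hs₁, ← Real.sqrt_mul hp.le]; congr 1; ring
  -- `G(x) = G(S(Tx))` with `S` the inverse scaling, so the integrand is `Φ ∘ T`
  set Φ : EuclideanSpace ℝ (Fin 2) → ℝ := fun y =>
    ψ y * gaussVortexProfile (toLp 2 ![s₀ * y 0, s₁ * y 1]) with hΦ
  have hint : (fun x : EuclideanSpace ℝ (Fin 2) =>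
      ψ (toLp 2 ![s₀⁻¹ * x 0, s₁⁻¹ * x 1]) * gaussVortexProfile x) =
      fun x => Φ (toLp 2 ![s₀⁻¹ * x 0, s₁⁻¹ * x 1]) := by
    funext x
    simp only [hΦ, Matrix.cons_val_zero, Matrix.cons_val_one, Matrix.cons_val_fin_one]
    congr 2
    ext i
    fin_cases i <;> simp [hs₀p.ne', hs₁p.ne']
  rw [hint, integral_comp_diag_fin_two (inv_ne_zero hs₀p.ne') (inv_ne_zero hs₁p.ne') Φ,
    ← integral_const_mul]
  refine integral_congr_ae (Eventually.of_forall fun y => ?_)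
  simp only [hΦ]
  have habs : |s₀⁻¹ * s₁⁻¹|⁻¹ = s₀ * s₁ := by
    rw [abs_of_pos (by positivity)]; field_simp
  rw [habs, gaussVortexProfile, norm_sq_toLp_fin_two, hprod]
  have hexp : Real.exp (-(((s₀ * y 0) ^ 2 + (s₁ * y 1) ^ 2) / 4)) =
      Real.exp (-((1 + lam) / 4 * y 0 ^ 2 + (1 - lam) / 4 * y 1 ^ 2)) := by
    congr 1
    rw [mul_pow, mul_pow, hs₀sq, hs₁sq]
    ring
  rw [hexp]
  ring

/-- **`∫ 𝒢_λ = 1`** (Gallay–Maekawa 2016, after (4.4)). [cite: GallayMaekawa2016, (4.4)] -/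
theorem integral_gaussLam :
    ∫ y : EuclideanSpace ℝ (Fin 2), Real.sqrt (1 - lam ^ 2) / (4 * Real.pi) *
        Real.exp (-((1 + lam) / 4 * y 0 ^ 2 + (1 - lam) / 4 * y 1 ^ 2)) = 1 := by
  have h := integral_comp_diagLam_mul_gaussVortexProfile hlam fun _ => 1
  simp only [one_mul] at h
  rw [← h, integral_gaussVortexProfile]

/-- `𝒢_λ > 0`. [folklore] -/
theorem gaussLam_pos (y : EuclideanSpace ℝ (Fin 2)) :
    0 < Real.sqrt (1 - lam ^ 2) / (4 * Real.pi) *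
        Real.exp (-((1 + lam) / 4 * y 0 ^ 2 + (1 - lam) / 4 * y 1 ^ 2)) := by
  obtain ⟨hl0, hl1⟩ := hlam
  have h : 0 < 1 - lam ^ 2 := by nlinarith
  have := Real.sqrt_pos.2 h
  positivity

/-! ### The anisotropic Poincaré inequality -/

/-- **Poincaré inequality for the anisotropic Gaussian `𝒢_λ`** (sharp anisotropic Dirichlet
form; Bakry–Gentil–Ledoux Prop. 4.1.1 with covariance `diag(2/(1+λ), 2/(1−λ))`): for
`λ ∈ (−1,1)` and `h ∈ C¹(ℝ²)` with `h, Dh` bounded,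
`∫ h²𝒢_λ − (∫ h𝒢_λ)² ≤ 2 ∫ ((∂₀h)²/(1+λ) + (∂₁h)²/(1−λ)) 𝒢_λ`.
Transported from the isotropic Gaussian-vortex case (`sq_integral_gaussVortexProfile_poincare`,
`λ = 0`) along `x ↦ (x₀/√(1+λ), x₁/√(1−λ))`. [folklore] -/
theorem sq_integral_gaussLam_poincare {h : EuclideanSpace ℝ (Fin 2) → ℝ} (hh : ContDiff ℝ 1 h)
    {C₀ C₁ : ℝ} (h0 : ∀ z, ‖h z‖ ≤ C₀) (h1 : ∀ z, ‖fderiv ℝ h z‖ ≤ C₁) :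
    (∫ y : EuclideanSpace ℝ (Fin 2), h y ^ 2 * (Real.sqrt (1 - lam ^ 2) / (4 * Real.pi) *
        Real.exp (-((1 + lam) / 4 * y 0 ^ 2 + (1 - lam) / 4 * y 1 ^ 2)))) -
      (∫ y : EuclideanSpace ℝ (Fin 2), h y * (Real.sqrt (1 - lam ^ 2) / (4 * Real.pi) *
        Real.exp (-((1 + lam) / 4 * y 0 ^ 2 + (1 - lam) / 4 * y 1 ^ 2)))) ^ 2 ≤
      2 * ∫ y : EuclideanSpace ℝ (Fin 2),
        ((1 + lam)⁻¹ * fderiv ℝ h y (EuclideanSpace.single 0 1) ^ 2 +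
          (1 - lam)⁻¹ * fderiv ℝ h y (EuclideanSpace.single 1 1) ^ 2) *
        (Real.sqrt (1 - lam ^ 2) / (4 * Real.pi) *
          Real.exp (-((1 + lam) / 4 * y 0 ^ 2 + (1 - lam) / 4 * y 1 ^ 2))) := by
  obtain ⟨hl0, hl1⟩ := hlam
  have hp : 0 < 1 + lam := by linarith
  have hq : 0 < 1 - lam := by linarith
  set s₀ : ℝ := Real.sqrt (1 + lam) with hs₀
  set s₁ : ℝ := Real.sqrt (1 - lam) with hs₁
  have hs₀p : 0 < s₀ := Real.sqrt_pos.2 hp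
  have hs₁p : 0 < s₁ := Real.sqrt_pos.2 hq
  have hs₀sq : s₀ ^ 2 = 1 + lam := Real.sq_sqrt hp.le
  have hs₁sq : s₁ ^ 2 = 1 - lam := Real.sq_sqrt hq.le
  -- the diagonal scaling `T x = (x₀/s₀, x₁/s₁)` as a continuous linear map
  let L : EuclideanSpace ℝ (Fin 2) →ₗ[ℝ] EuclideanSpace ℝ (Fin 2) :=
    { toFun := fun x => toLp 2 ![s₀⁻¹ * x 0, s₁⁻¹ * x 1]
      map_add' := fun x y => by
        ext i; fin_cases i <;> simp [mul_add]
      map_smul' := fun c x => by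
        ext i; fin_cases i <;> simp <;> ring }
  let T : EuclideanSpace ℝ (Fin 2) →L[ℝ] EuclideanSpace ℝ (Fin 2) := LinearMap.toContinuousLinearMap L
  have hT : ∀ x, T x = toLp 2 ![s₀⁻¹ * x 0, s₁⁻¹ * x 1] := fun x => rfl
  have hT0 : T (EuclideanSpace.single 0 1) = s₀⁻¹ • EuclideanSpace.single 0 1 := by
    rw [hT]; ext i; fin_cases i <;> simp
  have hT1 : T (EuclideanSpace.single 1 1) = s₁⁻¹ • EuclideanSpace.single 1 1 := by
    rw [hT]; ext i; fin_cases i <;> simp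
  -- the pulled-back function `g = h ∘ T` and its derivative
  have hg : ContDiff ℝ 1 (h ∘ T) := hh.comp T.contDiff
  have hgd : ∀ z, HasFDerivAt (h ∘ T) ((fderiv ℝ h (T z)).comp T) z := fun z =>
    ((hh.differentiable one_ne_zero) (T z)).hasFDerivAt.comp z T.hasFDerivAt
  have hg0 : ∀ z, ‖(h ∘ T) z‖ ≤ C₀ := fun z => h0 (T z)
  have hg1 : ∀ z, ‖fderiv ℝ (h ∘ T) z‖ ≤ C₁ * ‖T‖ := fun z => by
    rw [(hgd z).fderiv]
    exact (ContinuousLinearMap.opNorm_comp_le _ _).trans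
      (mul_le_mul_of_nonneg_right (h1 _) (norm_nonneg _))
  have hP := sq_integral_gaussVortexProfile_poincare hg hg0 hg1
  -- identify the squared norm of the derivative of `g`
  have hDg : ∀ z, ‖fderiv ℝ (h ∘ T) z‖ ^ 2 =
      (1 + lam)⁻¹ * fderiv ℝ h (T z) (EuclideanSpace.single 0 1) ^ 2 +
        (1 - lam)⁻¹ * fderiv ℝ h (T z) (EuclideanSpace.single 1 1) ^ 2 := by
    intro z
    rw [(hgd z).fderiv, ← sum_sq_apply_orthonormalBasis (EuclideanSpace.basisFun (Fin 2) ℝ)]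
    simp only [Fin.sum_univ_two, EuclideanSpace.basisFun_apply, ContinuousLinearMap.coe_comp,
      Function.comp_apply, hT0, hT1, map_smul, smul_eq_mul]
    rw [mul_pow, mul_pow, inv_pow, inv_pow, hs₀sq, hs₁sq]
  simp_rw [hDg] at hP
  -- change variables in the three integrals
  have e1 := integral_comp_diagLam_mul_gaussVortexProfile ⟨hl0, hl1⟩ fun y => h y ^ 2
  have e2 := integral_comp_diagLam_mul_gaussVortexProfile ⟨hl0, hl1⟩ h
  have e3 := integral_comp_diagLam_mul_gaussVortexProfile ⟨hl0, hl1⟩ fun y =>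
    (1 + lam)⁻¹ * fderiv ℝ h y (EuclideanSpace.single 0 1) ^ 2 +
      (1 - lam)⁻¹ * fderiv ℝ h y (EuclideanSpace.single 1 1) ^ 2
  simp only [Function.comp_apply, hT] at hP
  rw [← hs₀, ← hs₁] at e1 e2 e3
  simp only at e1 e2 e3
  rw [e1, e2, e3] at hP
  exact hP

/-- **Spectral-gap form of the anisotropic Poincaré inequality** (mean-zero functions): for
`λ ∈ (−1,1)`, `h ∈ C¹(ℝ²)` with `h, Dh` bounded and `∫ h 𝒢_λ = 0`,
`∫ h² 𝒢_λ ≤ 2 ∫ ((∂₀h)²/(1+λ) + (∂₁h)²/(1−λ)) 𝒢_λ`. [folklore] -/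
theorem integral_sq_mul_gaussLam_le {h : EuclideanSpace ℝ (Fin 2) → ℝ} (hh : ContDiff ℝ 1 h)
    {C₀ C₁ : ℝ} (h0 : ∀ z, ‖h z‖ ≤ C₀) (h1 : ∀ z, ‖fderiv ℝ h z‖ ≤ C₁)
    (hmean : ∫ y : EuclideanSpace ℝ (Fin 2), h y * (Real.sqrt (1 - lam ^ 2) / (4 * Real.pi) *
        Real.exp (-((1 + lam) / 4 * y 0 ^ 2 + (1 - lam) / 4 * y 1 ^ 2))) = 0) :
    ∫ y : EuclideanSpace ℝ (Fin 2), h y ^ 2 * (Real.sqrt (1 - lam ^ 2) / (4 * Real.pi) *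
        Real.exp (-((1 + lam) / 4 * y 0 ^ 2 + (1 - lam) / 4 * y 1 ^ 2))) ≤
      2 * ∫ y : EuclideanSpace ℝ (Fin 2),
        ((1 + lam)⁻¹ * fderiv ℝ h y (EuclideanSpace.single 0 1) ^ 2 +
          (1 - lam)⁻¹ * fderiv ℝ h y (EuclideanSpace.single 1 1) ^ 2) *
        (Real.sqrt (1 - lam ^ 2) / (4 * Real.pi) *
          Real.exp (-((1 + lam) / 4 * y 0 ^ 2 + (1 - lam) / 4 * y 1 ^ 2))) := by
  have := sq_integral_gaussLam_poincare hlam hh h0 h1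
  rw [hmean] at this
  simpa using this

end GaussLam

/-- **Isotropic form of the spectral gap, `0 ≤ λ < 1`** (the form used for `L_λ`): for
`h ∈ C¹(ℝ²)` with `h, Dh` bounded and `∫ h e^{−q_λ} = 0`,
`q_λ(y) = (1+λ)y₀²/4 + (1−λ)y₁²/4`,
`(1−λ)/2 · ∫ h² e^{−q_λ} ≤ ∫ ‖Dh‖² e^{−q_λ}`:
since `(∂₀h)²/(1+λ) + (∂₁h)²/(1−λ) ≤ ‖Dh‖²/(1−λ)` for `λ ≥ 0`. Stated for the unnormalised weight
`e^{−q_λ}` (the normalisation `√(1−λ²)/(4π)` of `𝒢_λ` cancels). The constant `(1−λ)/2` is the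
spectral gap of `L_λ` on mean-zero functions of `L²(𝒢_λ⁻¹ dx)`; it degenerates as `λ → 1`.
[folklore] -/
theorem integral_sq_mul_expNegQuadLam_le {lam : ℝ} (hlam : lam ∈ Set.Ico (0 : ℝ) 1)
    {h : EuclideanSpace ℝ (Fin 2) → ℝ} (hh : ContDiff ℝ 1 h)
    {C₀ C₁ : ℝ} (h0 : ∀ z, ‖h z‖ ≤ C₀) (h1 : ∀ z, ‖fderiv ℝ h z‖ ≤ C₁)
    (hmean : ∫ y : EuclideanSpace ℝ (Fin 2), h y *
        Real.exp (-((1 + lam) / 4 * y 0 ^ 2 + (1 - lam) / 4 * y 1 ^ 2)) = 0) :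
    (1 - lam) / 2 * ∫ y : EuclideanSpace ℝ (Fin 2), h y ^ 2 *
        Real.exp (-((1 + lam) / 4 * y 0 ^ 2 + (1 - lam) / 4 * y 1 ^ 2)) ≤
      ∫ y : EuclideanSpace ℝ (Fin 2), ‖fderiv ℝ h y‖ ^ 2 *
        Real.exp (-((1 + lam) / 4 * y 0 ^ 2 + (1 - lam) / 4 * y 1 ^ 2)) := by
  obtain ⟨hl0, hl1⟩ := hlam
  have hlam' : lam ∈ Set.Ioo (-1 : ℝ) 1 := ⟨by linarith, hl1⟩
  have hp : 0 < 1 + lam := by linarith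
  have hq : 0 < 1 - lam := by linarith
  set c : ℝ := Real.sqrt (1 - lam ^ 2) / (4 * Real.pi) with hc
  have hcpos : 0 < c := by
    have h : 0 < 1 - lam ^ 2 := by nlinarith
    have := Real.sqrt_pos.2 h
    positivity
  set ρ : EuclideanSpace ℝ (Fin 2) → ℝ := fun y =>
    Real.exp (-((1 + lam) / 4 * y 0 ^ 2 + (1 - lam) / 4 * y 1 ^ 2)) with hρ
  have hρpos : ∀ y, 0 < ρ y := fun y => Real.exp_pos _
  have hρi : Integrable ρ := by
    have := integrable_exp_neg_quadratic (a := (1 + lam) / 4) (b := (1 - lam) / 4)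
      (by positivity) (by positivity)
    exact this
  -- mean zero for the normalised weight
  have hmean' : ∫ y, h y * (c * ρ y) = 0 := by
    have : (fun y => h y * (c * ρ y)) = fun y => c * (h y * ρ y) := by funext y; ring
    rw [this, integral_const_mul, hmean, mul_zero]
  have hP := integral_sq_mul_gaussLam_le hlam' hh h0 h1 hmean'
  -- pull the constant `c` out of both sides
  have el : (fun y => h y ^ 2 * (c * ρ y)) = fun y => c * (h y ^ 2 * ρ y) := by funext y; ring
  have er : (fun y : EuclideanSpace ℝ (Fin 2) =>
      ((1 + lam)⁻¹ * fderiv ℝ h y (EuclideanSpace.single 0 1) ^ 2 +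
        (1 - lam)⁻¹ * fderiv ℝ h y (EuclideanSpace.single 1 1) ^ 2) * (c * ρ y)) =
      fun y => c * (((1 + lam)⁻¹ * fderiv ℝ h y (EuclideanSpace.single 0 1) ^ 2 +
        (1 - lam)⁻¹ * fderiv ℝ h y (EuclideanSpace.single 1 1) ^ 2) * ρ y) := by
    funext y; ring
  rw [el, er, integral_const_mul, integral_const_mul, ← mul_assoc, mul_comm 2 c, mul_assoc] at hP
  have hP' := le_of_mul_le_mul_left hP hcpos
  -- compare the anisotropic form with `‖Dh‖²/(1−λ)`
  have hC₁ : 0 ≤ C₁ := (norm_nonneg _).trans (h1 0)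
  have hb1 : ∀ y i, ‖fderiv ℝ h y (EuclideanSpace.single i (1 : ℝ))‖ ≤ C₁ := fun y i => by
    refine ((fderiv ℝ h y).le_opNorm _).trans ?_
    have hns : ‖(EuclideanSpace.single i (1 : ℝ) : EuclideanSpace ℝ (Fin 2))‖ = 1 := by simp
    rw [hns, mul_one]
    exact h1 y
  have hsq : ∀ y i, fderiv ℝ h y (EuclideanSpace.single i (1 : ℝ)) ^ 2 ≤ C₁ ^ 2 := fun y i => by
    rw [← sq_abs, ← Real.norm_eq_abs]
    exact pow_le_pow_left₀ (norm_nonneg _) (hb1 y i) 2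
  have hcont : ∀ i, Continuous fun y => fderiv ℝ h y (EuclideanSpace.single i (1 : ℝ)) := fun i =>
    (hh.continuous_fderiv one_ne_zero).clm_apply continuous_const
  have iform : Integrable fun y : EuclideanSpace ℝ (Fin 2) =>
      ((1 + lam)⁻¹ * fderiv ℝ h y (EuclideanSpace.single 0 1) ^ 2 +
        (1 - lam)⁻¹ * fderiv ℝ h y (EuclideanSpace.single 1 1) ^ 2) * ρ y := by
    refine hρi.bdd_mul (((continuous_const.mul ((hcont 0).pow 2)).add
      (continuous_const.mul ((hcont 1).pow 2))).aestronglyMeasurable)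
      (Eventually.of_forall (fun y => (?_ :
        ‖(1 + lam)⁻¹ * fderiv ℝ h y (EuclideanSpace.single 0 1) ^ 2 +
          (1 - lam)⁻¹ * fderiv ℝ h y (EuclideanSpace.single 1 1) ^ 2‖ ≤
          (1 + lam)⁻¹ * C₁ ^ 2 + (1 - lam)⁻¹ * C₁ ^ 2)))
    rw [Real.norm_of_nonneg (by positivity)]
    exact add_le_add (mul_le_mul_of_nonneg_left (hsq y 0) (by positivity))
      (mul_le_mul_of_nonneg_left (hsq y 1) (by positivity))
  have igrad : Integrable fun y => ‖fderiv ℝ h y‖ ^ 2 * ρ y :=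
    hρi.bdd_mul ((hh.continuous_fderiv one_ne_zero).norm.pow 2).aestronglyMeasurable
      (Eventually.of_forall fun y => by
        rw [norm_pow, norm_norm]; exact pow_le_pow_left₀ (norm_nonneg _) (h1 y) 2)
  -- pointwise comparison of the forms
  have hpt : ∀ y, ((1 + lam)⁻¹ * fderiv ℝ h y (EuclideanSpace.single 0 1) ^ 2 +
        (1 - lam)⁻¹ * fderiv ℝ h y (EuclideanSpace.single 1 1) ^ 2) * ρ y ≤
      (1 - lam)⁻¹ * (‖fderiv ℝ h y‖ ^ 2 * ρ y) := by
    intro y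
    have hsum : fderiv ℝ h y (EuclideanSpace.single 0 1) ^ 2 +
        fderiv ℝ h y (EuclideanSpace.single 1 1) ^ 2 = ‖fderiv ℝ h y‖ ^ 2 := by
      rw [← sum_sq_apply_orthonormalBasis (EuclideanSpace.basisFun (Fin 2) ℝ)]
      simp [Fin.sum_univ_two]
    rw [← hsum]
    have hinv : (1 + lam)⁻¹ ≤ (1 - lam)⁻¹ := by
      rw [inv_le_inv₀ hp hq]; linarith
    have h0sq := sq_nonneg (fderiv ℝ h y (EuclideanSpace.single 0 1))
    have hkey := mul_le_mul_of_nonneg_right hinv (mul_nonneg h0sq (hρpos y).le)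
    nlinarith [hkey, sq_nonneg (fderiv ℝ h y (EuclideanSpace.single 1 1)), (hρpos y).le]
  have hcmp := integral_mono iform (igrad.const_mul _) hpt
  rw [integral_const_mul] at hcmp
  -- combine
  have key : ∫ y, h y ^ 2 * ρ y ≤ 2 * ((1 - lam)⁻¹ * ∫ y, ‖fderiv ℝ h y‖ ^ 2 * ρ y) :=
    hP'.trans (by gcongr)
  rw [← mul_assoc] at key
  have h2 : 0 < 2 * (1 - lam)⁻¹ := by positivity
  calc (1 - lam) / 2 * ∫ y, h y ^ 2 * ρ y
      ≤ (1 - lam) / 2 * (2 * (1 - lam)⁻¹ * ∫ y, ‖fderiv ℝ h y‖ ^ 2 * ρ y) := by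
        gcongr
    _ = ∫ y, ‖fderiv ℝ h y‖ ^ 2 * ρ y := by field_simp

end Literature.Analysis.FluidPDE
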